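import Summits.Ventures.PercRepro.ColumnSum

/-!
# The three-colour Marica–Schönheim statement when the pair `{⊥, ⊤}` is touched

For `MSr 3` (ColumnSum): `T` complement-closed, `κ : Config S → Fin 3` with `κ Aᶜ ≠ κ A`. If
`⊥ ∈ T` (hence `⊤ = ⊥ᶜ ∈ T`), then EVERY member `x` of `T` or its complement is a within-colour
difference: with `i = κ ⊥` and `j = κ ⊤` (`i ≠ j`), `x = x \ ⊥` if `κ x = i`, `x = ⊤ \ xᶜ` if
`κ xᶜ = j`, and otherwise `κ x ≠ i`, `κ xᶜ ≠ j` force `κ xᶜ = i` or `κ x = j` (three colours, and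
`κ xᶜ ≠ κ x`), which puts `xᶜ = xᶜ \ ⊥` or `xᶜ = ⊤ \ x` into the differences. Hence
`T ⊆ classDiffs T κ ∪ (classDiffs T κ).image compl` and `|T| ≤ 2 |classDiffs T κ|`
(`msr3_card_le_of_bot_mem`). This is lemma H7 of conjectures/MINE-1.md §H (the `∅` WLOG of the
SAT census, which voids every cube touching the empty pair); it is specific to three colours.
-/

namespace PercRepro

open Finset
open scoped FinsetFamily

variable {S : Type} [Fintype S] [DecidableEq S]

omit [DecidableEq S] in
/-- A within-colour difference of two members lies in `classDiffs`. -/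
theorem sdiff_mem_classDiffs' {r : ℕ} {T : Finset (Config S)} {κ : Config S → Fin r}
    {A B : Config S} (hA : A ∈ T) (hB : B ∈ T) (hAB : κ A = κ B) : A \ B ∈ classDiffs T κ := by
  classical
  unfold classDiffs
  simp only [Finset.mem_biUnion, Finset.mem_univ, true_and]
  exact ⟨κ A, Finset.mem_diffs.2 ⟨A, by simp [hA], B, by simp [hB, hAB], rfl⟩⟩

omit [DecidableEq S] in
/-- When the pair `{⊥, ⊤}` is touched, every member or its complement is a within-colour
difference. -/
theorem mem_classDiffs_or_compl_mem_of_bot_mem {T : Finset (Config S)} {κ : Config S → Fin 3}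
    (hT : ∀ A ∈ T, Aᶜ ∈ T) (hκ : ∀ A ∈ T, κ Aᶜ ≠ κ A) (hbot : (⊥ : Config S) ∈ T) {x : Config S}
    (hx : x ∈ T) : x ∈ classDiffs T κ ∨ xᶜ ∈ classDiffs T κ := by
  have htop : (⊤ : Config S) ∈ T := by simpa using hT ⊥ hbot
  have hij : κ (⊤ : Config S) ≠ κ ⊥ := by simpa using hκ ⊥ hbot
  have hxc : xᶜ ∈ T := hT x hx
  -- the four ways a difference can equal `x` or `xᶜ`
  have h1 : κ x = κ ⊥ → x ∈ classDiffs T κ := fun h => by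
    have := sdiff_mem_classDiffs' hx hbot h
    simpa using this
  have h2 : κ (⊤ : Config S) = κ xᶜ → x ∈ classDiffs T κ := fun h => by
    have := sdiff_mem_classDiffs' htop hxc h
    simpa using this
  have h3 : κ xᶜ = κ ⊥ → xᶜ ∈ classDiffs T κ := fun h => by
    have := sdiff_mem_classDiffs' hxc hbot h
    simpa using this
  have h4 : κ (⊤ : Config S) = κ x → xᶜ ∈ classDiffs T κ := fun h => by
    have := sdiff_mem_classDiffs' htop hx h
    simpa using this
  -- three colours: `κ x ≠ κ xᶜ`, `κ ⊤ ≠ κ ⊥`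
  have hcol : κ xᶜ ≠ κ x := hκ x hx
  have key : ∀ a b c d : Fin 3, b ≠ a → d ≠ c → (c = a ∨ b = d ∨ d = a ∨ b = c) := by decide
  rcases key (κ ⊥) (κ ⊤) (κ x) (κ xᶜ) hij hcol with h | h | h | h
  · exact Or.inl (h1 h)
  · exact Or.inl (h2 h)
  · exact Or.inr (h3 h)
  · exact Or.inr (h4 h)

omit [DecidableEq S] in
/-- **`MSr 3` holds whenever the pair `{⊥, ⊤}` is touched** (lemma H7): `|T| ≤ 2 |classDiffs T κ|`. -/
theorem msr3_card_le_of_bot_mem (T : Finset (Config S)) (κ : Config S → Fin 3)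
    (hT : ∀ A ∈ T, Aᶜ ∈ T) (hκ : ∀ A ∈ T, κ Aᶜ ≠ κ A) (hbot : (⊥ : Config S) ∈ T) :
    T.card ≤ 2 * (classDiffs T κ).card := by
  classical
  have hsub : T ⊆ classDiffs T κ ∪ (classDiffs T κ).image compl := by
    intro x hx
    rcases mem_classDiffs_or_compl_mem_of_bot_mem hT hκ hbot hx with h | h
    · exact Finset.mem_union.2 (Or.inl h)
    · exact Finset.mem_union.2 (Or.inr (Finset.mem_image.2 ⟨xᶜ, h, compl_compl x⟩))
  calc T.card ≤ (classDiffs T κ ∪ (classDiffs T κ).image compl).card := Finset.card_le_card hsub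
    _ ≤ (classDiffs T κ).card + ((classDiffs T κ).image compl).card := Finset.card_union_le _ _
    _ ≤ (classDiffs T κ).card + (classDiffs T κ).card :=
        Nat.add_le_add_left Finset.card_image_le _
    _ = 2 * (classDiffs T κ).card := by ring

end PercRepro
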